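import Literature.Computability.Cryptography.PeikertReduction
import Literature.Algebra.EuclideanLattices.SuccessiveMinimaProofs
import Literature.Probability.Distributions.GaussianShiftHiding
import HarnessLib

/-!
# Peikert's reduction, first component: the perturbation step with a rounded Gaussian (parameters)

Topic `Computability/Cryptography` (family `pqc`), sequel of `PeikertReduction.lean` (architecture of
**pqc.S20** `peikert_gapSVPZeta_to_lwe_classical`; Peikert, STOC 2009, Thm. 3.1) and of
`Literature.Probability.Distributions.GaussianShiftHiding` (the rounded Gaussian `W_σ` on `ℤⁿ`:
`roundedGaussian`, its hiding bound `tvDist_roundedGaussian_map_add_le_one_sub_exp` and its Chernoff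
norm tail `roundedGaussian_norm_gt_le`). It fixes the PERTURBATION of the first component ("GapSVP to
BDD", full version p. 12, step 1: "Choose a point `w` uniformly at random from the ball `d'·Bₙ`,
`d' = d·√(n/(4 log n))`, and let `x = w mod B`") in the form a Turing machine works with — an integer
perturbation `w ∼ W_{σ(D)}` of width `σ(D) = D/(8√(log n))` on the `M`-fold copy `(M bᵢ)ᵢ` of the
input basis, `D = M·d` — and PROVES that this choice does what Peikert's `w ∼ U(d'·Bₙ)` does in both
halves of his analysis, with explicit constants:

* `Peikert2009.no_case_scaled` — the NO-case analysis of `PeikertReduction.lean` (`no_case`) on a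
  scaled copy: Gram–Schmidt norms `≥ M`, `λ₁ > γ·D`, `D ≤ Mζ/γ`; for `‖w‖ ≤ d'(D) = D√n/(2√(log n))`,
  `x ≡ w (mod L)` and `r ∈ [r₀, 2r₀]`, `r₀ = q√(2n)/(γD)`, the call `((J, x), r)` is admissible for
  Prop. 3.2/2.8 and its only admissible answer is `x - w` (the analysis is scale-invariant).
* `Peikert2009.roundedGaussian_perturbRadius_lt_norm_le` — NO case, the perturbation is short:
  for `D ≥ 4√(log n)`, `Pr_{W_{σ(D)}}[‖w‖ > d'(D)] ≤ 2^{n/2} e^{-2n}`.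
* `Peikert2009.exists_int_vector_norm_le` — YES case: `λ₁(L(J)) ≤ D` is attained by a nonzero
  integer vector `z` of norm `≤ D`.
* `Peikert2009.prob_names_perturbation_roundedGaussian_le` — YES case, the [GG00] Lemma 2.1 role:
  for ANY solver reading a lattice-shift-invariant view of `w` (as `w mod J`) with independent coins,
  `Pr[it names w] ≤ 1 - (2π)^{-1/2} e^{-(D/(2σ)+1)²/2}/2`; and
  `Peikert2009.inv_poly_le_hiding_advantage`: at `σ = σ(D)` this advantage is `≥ 1/(9n¹²)` (`n ≥ 3`).

So one iteration of the first component, run on `(nB, nd)` with `w ∼ W_{σ(nd)}` (`n ≥ 6` gives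
`nd ≥ 4√(log n)`), errs in the NO case with probability `≤ ε_R(n) + 2^{n/2}e^{-2n}` (`ε_R` the failure
bound of the BDD solver `R` on admissible inputs, plus the sampling error of `W`) and names `w` in the
YES case with probability `≤ 1 - 1/(9n¹²)`; `N = n¹³` independent iterations decide. What remains of
hypothesis `h₁` of `peikert_gapSVPZeta_to_lwe_classical_of_components` after this file is machine
plumbing only: the `OracleAlg` (parsing, a coin-driven sampler for `W_σ` with negligible error, `w mod J`,
a rational `r ∈ [r₀, 2r₀]`, `N` sub-runs of `R`, comparison), its `IsPolyTime` proof, and the product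
structure of its coin string (repetition and union bounds). Everything here is PROVED; no named fact.

## Faithfulness notes

* Peikert perturbs with the uniform distribution on a real ball and invokes the Goldreich–Goldwasser
  overlap bound (Lemma 2.1); only `Δ(w, z + w) ≤ 1 - 1/poly(n)` for `‖z‖ ≤ d` and `‖w‖ ≤ d'` are used
  (p. 12), and "all the arguments can be made rigorous by using a suitable amount of precision" (p. 7).
  A rounded spherical Gaussian on the scaled integer grid has both properties with the constants above;
  the scale `M` buys the precision (the rounding error `√n/2` must stay below `d'`).
* Constants are crude (`1/(9n¹²)`, `2^{n/2}e^{-2n}`); only inverse-polynomial / negligible matters.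

## References

* C. Peikert, *Public-key cryptosystems from the worst-case shortest vector problem*, STOC 2009; full
  version Dagstuhl Seminar Proc. 08491 (2009), proof of Thm. 3.1 (pp. 11–12), Lemma 2.1, §2 p. 7
  [Peikert2009].
* O. Goldreich, S. Goldwasser, *On the limits of nonapproximability of lattice problems*, JCSS 60
  (2000) [GoldreichGoldwasser2000].
-/

noncomputable section

open Filter Asymptotics Metric Literature.Computability.Complexity
  Literature.Algebra.EuclideanLattices Literature.Computability.Cryptography
open scoped ENNReal

namespace Literature.Computability.Cryptography

namespace Peikert2009

/-! ### NO instances at scale `M`: admissibility and forced answer on a scaled copy of the lattice -/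

/-- **The NO case of Thm. 3.1 on a scaled instance.** Let `J` be a nonsingular integer instance of
dimension `n ≥ 2` whose Gram–Schmidt norms are all `≥ M` and whose minimum distance exceeds `γ·D`,
where `M ≥ 1`, `D ≥ M` and `D ≤ M·ζ/γ` (for the `M`-fold copy `J = (M bᵢ)ᵢ` of a NO instance `(B, d)` of
`GapSVP_{ζ,γ}`: `D = M d`, `‖b̃ᵢ(J)‖ = M‖b̃ᵢ‖ ≥ M`, `λ₁(L(J)) = Mλ₁(L(B)) > γ M d`), in the regime of
Thm. 3.1 (`α ∈ (0,1)`, `γ ≥ 2n/(α√(log n))`, `q ≥ ζ f√(log n)/√n`, `f ≥ 0`, `q ≥ 1`). Then for every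
perturbation `w ∈ ℤⁿ` with `‖w‖ ≤ d'(D) = D√n/(2√(log n))`, every target `x ≡ w (mod L(J))` and every
rational `r ∈ [r₀, 2r₀]`, `r₀ = q√(2n)/(γ D)`: the call `((J, x), r)` is `f`-admissible and its only
admissible answer is `x - w`. (Peikert's NO-case analysis, full version p. 12, is scale-invariant: the
conditions `f√(log n) ≤ r‖b̃ᵢ‖`, `√2 q η(Λ*) ≤ r`, `dist ≤ αq/(√2 r)` of Prop. 3.2/2.8 are unchanged under
`(B, x, r) ↦ (MB, Mx, r/M)`; the reduction uses the scaled copy to afford an integer perturbation grid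
finer than `d'`.) The case `M = 1`, `D = d` is `no_case`. [cite: Peikert2009, Thm. 3.1 proof (NO case, full version p. 12)] -/
theorem no_case_scaled {q : ℕ → ℕ} {α f ζ γ : ℕ → ℝ} (J : LatticeInstance) (hJ : J.IsNonsingular)
    {M D : ℝ} (hM : 1 ≤ M) (hMD : M ≤ D) (hGS : ∀ i, M ≤ ‖InnerProductSpace.gramSchmidt ℝ J.vec i‖)
    (hno : γ J.n * D < minNorm J.lattice) (hDζ : D ≤ M * ζ J.n / γ J.n)
    (hn : 2 ≤ J.n) (hα : 0 < α J.n) (hα1 : α J.n < 1) (hf : 0 ≤ f J.n) (hq1 : 1 ≤ q J.n)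
    (hγ : 2 * J.n / (α J.n * Real.sqrt (Real.log J.n)) ≤ γ J.n)
    (hq : ζ J.n * f J.n * Real.sqrt (Real.log J.n) / Real.sqrt J.n ≤ q J.n)
    (x w : Fin J.n → ℤ) (hxw : intVecToEuclidean J.n x - intVecToEuclidean J.n w ∈ J.lattice)
    (hw : ‖intVecToEuclidean J.n w‖ ≤ perturbRadius J.n D) (r : ℚ)
    (hr : q J.n * Real.sqrt (2 * J.n) / (γ J.n * D) ≤ r)
    (hr2 : (r : ℝ) ≤ 2 * (q J.n * Real.sqrt (2 * J.n) / (γ J.n * D))) :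
    BDDAdmissible q α f (⟨J, x⟩, r) ∧
      ∀ v, CVP.IsSolution (fun _ => 1) ⟨J, x⟩ v → v = x - w := by
  -- notation and positivity
  set L := Real.sqrt (Real.log J.n) with hLdef
  set S := Real.sqrt (J.n : ℝ) with hSdef
  have hn2 : (2 : ℝ) ≤ J.n := by exact_mod_cast hn
  have hLpos : 0 < L := lt_trans (by norm_num) (half_lt_sqrt_log hn)
  have hS1 : 1 ≤ S := by
    rw [hSdef, show (1 : ℝ) = Real.sqrt 1 by simp]
    exact Real.sqrt_le_sqrt (by linarith)
  have hSpos : 0 < S := lt_of_lt_of_le one_pos hS1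
  have hSsq : S * S = J.n := Real.mul_self_sqrt (by linarith)
  have hS2n : Real.sqrt (2 * (J.n : ℝ)) = Real.sqrt 2 * S := Real.sqrt_mul (by norm_num) _
  have hsqrt2pos : 0 < Real.sqrt 2 := Real.sqrt_pos.2 (by norm_num)
  have hsqrt2sq : Real.sqrt 2 * Real.sqrt 2 = 2 := Real.mul_self_sqrt (by norm_num)
  have hMpos : 0 < M := lt_of_lt_of_le one_pos hM
  have hDpos : 0 < D := lt_of_lt_of_le hMpos hMD
  have hγ0 : 0 < 2 * J.n / (α J.n * L) := div_pos (by linarith) (mul_pos hα hLpos)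
  have hγpos : 0 < γ J.n := lt_of_lt_of_le hγ0 hγ
  have hd₀pos : 0 < γ J.n * D := mul_pos hγpos hDpos
  have hqpos : (0 : ℝ) < q J.n := by exact_mod_cast hq1
  have hq0 : (0 : ℝ) ≤ q J.n := hqpos.le
  -- `γ D ≤ M ζ`
  have hγDζ : γ J.n * D ≤ M * ζ J.n := by
    have := (le_div_iff₀ hγpos).1 hDζ
    linarith [mul_comm (γ J.n) D]
  -- the window `r₀ ≤ r ≤ 2 r₀`
  set r₀ : ℝ := q J.n * Real.sqrt (2 * J.n) / (γ J.n * D) with hr₀def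
  have hr₀pos : 0 < r₀ := div_pos (mul_pos hqpos (Real.sqrt_pos.2 (by positivity))) hd₀pos
  have hrpos : (0 : ℝ) < r := lt_of_lt_of_le hr₀pos hr
  have hrpos' : 0 < r := by exact_mod_cast hrpos
  -- (GPV condition) `f √(log n) ≤ r M`: `r M ≥ r₀ M ≥ q√(2n)/ζ ≥ √2 f √(log n)`
  have hfr : f J.n * L ≤ (r : ℝ) * M := by
    have h0 : r₀ * M ≤ (r : ℝ) * M := mul_le_mul_of_nonneg_right hr hMpos.le
    refine le_trans ?_ h0
    rw [hr₀def, div_mul_eq_mul_div, le_div_iff₀ hd₀pos]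
    have hq' : ζ J.n * f J.n * L ≤ q J.n * S := (div_le_iff₀ hSpos).1 hq
    have h1 : f J.n * L * (γ J.n * D) ≤ f J.n * L * (M * ζ J.n) :=
      mul_le_mul_of_nonneg_left hγDζ (mul_nonneg hf hLpos.le)
    have h2 : f J.n * L * (M * ζ J.n) ≤ q J.n * S * M := by
      have := mul_le_mul_of_nonneg_right hq' hMpos.le
      linarith [mul_comm (f J.n * L) (M * ζ J.n)]
    have h3 : q J.n * S * M ≤ q J.n * Real.sqrt (2 * J.n) * M := by
      rw [hS2n]
      have h12 : (1 : ℝ) ≤ Real.sqrt 2 := by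
        rw [show (1 : ℝ) = Real.sqrt 1 by simp]; exact Real.sqrt_le_sqrt (by norm_num)
      have : S ≤ Real.sqrt 2 * S := by nlinarith
      exact mul_le_mul_of_nonneg_right (mul_le_mul_of_nonneg_left this hq0) hMpos.le
    linarith
  -- (distance condition) `‖w‖ ≤ d'(D) ≤ α q/(√2 r)`
  have hdist : infDist (CVPInstance.targetE ⟨J, x⟩) J.lattice ≤ α J.n * q J.n / (Real.sqrt 2 * r) := by
    refine (infDist_targetE_le_norm ⟨J, x⟩ hxw).trans (hw.trans ?_)
    show perturbRadius J.n D ≤ α J.n * q J.n / (Real.sqrt 2 * r)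
    rw [perturbRadius, div_le_div_iff₀ (mul_pos two_pos hLpos) (mul_pos hsqrt2pos hrpos)]
    have hγ' : 2 * (J.n : ℝ) ≤ γ J.n * (α J.n * L) := (div_le_iff₀ (mul_pos hα hLpos)).1 hγ
    have hr2' : (r : ℝ) * (γ J.n * D) ≤ 2 * (q J.n * (Real.sqrt 2 * S)) := by
      rw [← hS2n]
      have := (le_div_iff₀ hd₀pos).1 (show (r : ℝ) ≤ 2 * (q J.n * Real.sqrt (2 * J.n)) / (γ J.n * D) by
        rw [mul_div_assoc]; exact hr2)
      linarith
    have key : D * S * (Real.sqrt 2 * r) * (γ J.n * D) ≤ α J.n * q J.n * (2 * L) * (γ J.n * D) := by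
      calc D * S * (Real.sqrt 2 * r) * (γ J.n * D)
          = D * S * Real.sqrt 2 * (r * (γ J.n * D)) := by ring
        _ ≤ D * S * Real.sqrt 2 * (2 * (q J.n * (Real.sqrt 2 * S))) :=
            mul_le_mul_of_nonneg_left hr2' (by positivity)
        _ = 2 * D * q J.n * (2 * J.n) := by
            have : S * Real.sqrt 2 * (Real.sqrt 2 * S) = 2 * J.n := by
              calc S * Real.sqrt 2 * (Real.sqrt 2 * S) = (Real.sqrt 2 * Real.sqrt 2) * (S * S) := by ring
                _ = 2 * J.n := by rw [hsqrt2sq, hSsq]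
            calc D * S * Real.sqrt 2 * (2 * (q J.n * (Real.sqrt 2 * S)))
                = 2 * D * q J.n * (S * Real.sqrt 2 * (Real.sqrt 2 * S)) := by ring
              _ = 2 * D * q J.n * (2 * J.n) := by rw [this]
        _ ≤ 2 * D * q J.n * (γ J.n * (α J.n * L)) :=
            mul_le_mul_of_nonneg_left hγ' (by positivity)
        _ = α J.n * q J.n * (2 * L) * (γ J.n * D) := by ring
    exact le_of_mul_le_mul_right key hd₀pos
  refine ⟨bddAdmissible_of_le_minNorm ⟨J, x⟩ r hJ hGS hd₀pos hno.le hr hrpos' hfr hdist, ?_⟩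
  -- (forced answer) `2‖w‖ ≤ 2 d'(D) = D S/L < γ D < λ₁`
  intro v hv
  refine eq_target_sub_of_isSolution ⟨J, x⟩ hxw (lt_of_le_of_lt ?_ hno) hv
  have hγ' : 2 * (J.n : ℝ) ≤ γ J.n * (α J.n * L) := (div_le_iff₀ (mul_pos hα hLpos)).1 hγ
  calc 2 * ‖intVecToEuclidean J.n w‖ ≤ 2 * perturbRadius J.n D := by linarith
    _ = D * S / L := by
        rw [perturbRadius, ← hSdef, ← hLdef]
        field_simp
    _ ≤ γ J.n * D := by
        rw [div_le_iff₀ hLpos]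
        have h1 : γ J.n * (α J.n * L) ≤ γ J.n * L := by
          have : α J.n * L ≤ L := by nlinarith
          exact mul_le_mul_of_nonneg_left this hγpos.le
        have hSn : S ≤ J.n := by nlinarith
        nlinarith

/-! ### YES instances: a short integer lattice vector exists -/

/-- On a nonsingular integer instance of positive dimension with `λ₁(L(B)) ≤ D` there is a nonzero
INTEGER vector `z` of `L(B)` with `‖z‖ ≤ D` (attainment of the minimum, `exists_mem_norm_eq_minNorm_holds`,
and integrality of lattice vectors). In the YES case of Thm. 3.1 this is the shortest vector `z`,
`‖z‖ = λ₁(Λ) ≤ d`, by which the experiment is shifted (full version p. 12). [cite: Peikert2009, Thm. 3.1 proof (YES case, full version p. 12)] -/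
theorem exists_int_vector_norm_le {J : LatticeInstance} (hJ : J.IsNonsingular) (hn : 1 ≤ J.n) {D : ℝ}
    (hD : minNorm J.lattice ≤ D) :
    ∃ z : Fin J.n → ℤ, z ≠ 0 ∧ intVecToEuclidean J.n z ∈ J.lattice ∧ ‖intVecToEuclidean J.n z‖ ≤ D := by
  have hbot : J.lattice ≠ ⊥ := by
    intro h
    have hi : J.vec ⟨0, hn⟩ ∈ J.lattice := Submodule.subset_span ⟨⟨0, hn⟩, rfl⟩
    rw [h, Submodule.mem_bot] at hi
    exact (LatticeInstance.linearIndependent_vec hJ).ne_zero ⟨0, hn⟩ hi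
  obtain ⟨v, hvL, hv0, hvnorm⟩ := exists_mem_norm_eq_minNorm_holds J.lattice hbot
  obtain ⟨c, hc⟩ := (J.mem_lattice_iff v).1 hvL
  refine ⟨Matrix.vecMul c J.basis, ?_, ?_, ?_⟩
  · intro hz
    apply hv0
    rw [← hc, LatticeInstance.ofCoeffs, hz, map_zero]
  · exact J.ofCoeffs_mem_lattice c
  · have : intVecToEuclidean J.n (Matrix.vecMul c J.basis) = v := hc
    rw [this, hvnorm]; exact hD

/-! ### The rounded Gaussian perturbation: width, norm tail (NO case), hiding (YES case) -/

/-- The width `σ(D) = D/(8√(log n))` of the rounded Gaussian perturbation used at scale `D = M·d`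
(so that `‖w‖ ≤ d'(D) = D√n/(2√(log n))` with overwhelming probability while shifts of norm `≤ D`
stay hidden with advantage `1/poly(n)`; Peikert's `w ∼ U(d'·Bₙ)` plays the same two roles, full
version p. 12). [cite: Peikert2009, Thm. 3.1 proof (step 1, full version p. 12)] -/
def perturbWidth (n : ℕ) (D : ℝ) : ℝ :=
  D / (8 * Real.sqrt (Real.log n))

/-- `√2 < 3/2`. [folklore] -/
theorem sqrt_two_lt_three_halves : Real.sqrt 2 < 3 / 2 := by
  rw [Real.sqrt_lt' (by norm_num)]; norm_num

/-- The integer vector `w` read in `ℝⁿ` by the probability library (`WithLp.toLp 2 (↑w)`) is the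
lattice library's `intVecToEuclidean n w`. [folklore] -/
theorem toLp_intCast_eq_intVecToEuclidean (n : ℕ) (w : Fin n → ℤ) :
    (WithLp.toLp 2 fun i => (w i : ℝ) : EuclideanSpace ℝ (Fin n)) = intVecToEuclidean n w := by
  ext i
  rw [intVecToEuclidean_apply]

/-- **NO case, the perturbation is short enough** (the role of "`w` chosen from `d'·Bₙ`"): for
`n ≥ 2` and a scale `D ≥ 4√(log n)`, the rounded Gaussian of width `σ(D)` exceeds Peikert's radius
`d'(D) = D√n/(2√(log n))` only with probability `≤ 2^{n/2} e^{-2n} (≤ e^{-n})`: by the Chernoff bound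
`roundedGaussian_norm_gt_le` at `t = 8n`, since `σ(D)√(8n) + √n/2 ≤ d'(D)` iff `2√(log n) ≤ (2 - √2) D`.
[cite: Peikert2009, Thm. 3.1 proof (NO case, full version p. 12)] -/
theorem roundedGaussian_perturbRadius_lt_norm_le {n : ℕ} (hn : 2 ≤ n) {D : ℝ}
    (hD : 4 * Real.sqrt (Real.log n) ≤ D) :
    ((Literature.Probability.Distributions.roundedGaussian n (perturbWidth n D)).toOuterMeasure
        {w | perturbRadius n D < ‖intVecToEuclidean n w‖}).toReal ≤
      (2 : ℝ) ^ ((n : ℝ) / 2) * Real.exp (-(2 * n)) := by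
  set L := Real.sqrt (Real.log n) with hLdef
  set S := Real.sqrt (n : ℝ) with hSdef
  have hn2 : (2 : ℝ) ≤ n := by exact_mod_cast hn
  have hLpos : 0 < L := lt_trans (by norm_num) (half_lt_sqrt_log hn)
  have hSpos : 0 < S := Real.sqrt_pos.2 (by linarith)
  have hDpos : 0 < D := lt_of_lt_of_le (by positivity) hD
  have hσ : 0 < perturbWidth n D := div_pos hDpos (by positivity)
  have hL0 : L ≠ 0 := hLpos.ne'
  have hS0 : S ≠ 0 := hSpos.ne'
  -- the Chernoff threshold at `t = 8n` is below Peikert's radius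
  have hthr : perturbWidth n D * Real.sqrt (8 * (n : ℝ)) + Real.sqrt n / 2 ≤ perturbRadius n D := by
    have h8 : Real.sqrt (8 * (n : ℝ)) = 2 * Real.sqrt 2 * S := by
      rw [show (8 : ℝ) * n = (2 * 2) * (2 * n) by ring, Real.sqrt_mul (by norm_num), Real.sqrt_mul_self (by norm_num),
        Real.sqrt_mul (by norm_num), hSdef]; ring
    rw [h8, perturbWidth, perturbRadius, ← hLdef, ← hSdef]
    rw [show D / (8 * L) * (2 * Real.sqrt 2 * S) + S / 2 = S * (D * Real.sqrt 2 + 2 * L) / (4 * L) by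
      field_simp; ring]
    rw [div_le_div_iff₀ (by positivity) (by positivity)]
    have hkey : D * Real.sqrt 2 + 2 * L ≤ 2 * D := by
      nlinarith [mul_nonneg (sub_nonneg.2 sqrt_two_lt_three_halves.le) hDpos.le, Real.sqrt_nonneg 2, hD, hLpos.le]
    have : S * (D * Real.sqrt 2 + 2 * L) * (2 * L) ≤ S * (2 * D) * (2 * L) :=
      mul_le_mul_of_nonneg_right (mul_le_mul_of_nonneg_left hkey hSpos.le) (by positivity)
    linarith
  have hsub : {w : Fin n → ℤ | perturbRadius n D < ‖intVecToEuclidean n w‖} ⊆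
      {w | perturbWidth n D * Real.sqrt (8 * (n : ℝ)) + Real.sqrt n / 2 <
        ‖(WithLp.toLp 2 fun i => (w i : ℝ) : EuclideanSpace ℝ (Fin n))‖} := by
    intro w hw
    simp only [Set.mem_setOf_eq] at hw ⊢
    rw [toLp_intCast_eq_intVecToEuclidean]
    exact lt_of_le_of_lt hthr hw
  have hmono := (Literature.Probability.Distributions.roundedGaussian n (perturbWidth n D)).toOuterMeasure.mono hsub
  refine (ENNReal.toReal_mono (toOuterMeasure_ne_top _ _) hmono).trans ?_
  refine (Literature.Probability.Distributions.roundedGaussian_norm_gt_le n hσ (8 * (n : ℝ))).trans_eq ?_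
  congr 1
  congr 1
  ring

/-- **YES case, the perturbation hides the shortest vector** (the role of Lemma 2.1 [GG00]): if
`L(J)` has a nonzero integer vector of norm `≤ D` and the view `red` of the BDD solver is invariant
under lattice shifts of the perturbation (as `x = w mod J`), then whatever the solver computes from
the view and from coins independent of `w ∼ W_σ` (`W_σ` the rounded Gaussian of width `σ > 0`),
`Pr[it names w] ≤ 1 - (2π)^{-1/2} e^{-(D/(2σ)+1)²/2}/2` (the tree's `prob_names_perturbation_le`:
`≤ (1 + Δ(W_σ, z + W_σ))/2`, with `Δ ≤ 1 - (2π)^{-1/2} e^{-(‖z‖/(2σ)+1)²/2}`,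
`tvDist_roundedGaussian_map_add_le_one_sub_exp`). [cite: Peikert2009, Thm. 3.1 proof (YES case, full version p. 12) with Lemma 2.1] -/
theorem prob_names_perturbation_roundedGaussian_le {J : LatticeInstance} {C X β : Type*} (μ : PMF C)
    (red : (Fin J.n → ℤ) → X) (lift : X → (Fin J.n → ℤ)) (run : X → C → β) (dec : β → (Fin J.n → ℤ))
    (hred : ∀ z w : Fin J.n → ℤ, intVecToEuclidean J.n z ∈ J.lattice → red (z + w) = red w)
    {D σ : ℝ} (hσ : 0 < σ)
    (hz : ∃ z : Fin J.n → ℤ, z ≠ 0 ∧ intVecToEuclidean J.n z ∈ J.lattice ∧ ‖intVecToEuclidean J.n z‖ ≤ D) :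
    ((μ.bind fun c => (Literature.Probability.Distributions.roundedGaussian J.n σ).map fun w => (c, w)).toOuterMeasure
        {p | dec (run (red p.2) p.1) = lift (red p.2) - p.2}).toReal ≤
      1 - (Real.sqrt (2 * Real.pi))⁻¹ * Real.exp (-(D / (2 * σ) + 1) ^ 2 / 2) / 2 := by
  obtain ⟨z, hz0, hzL, hzD⟩ := hz
  have h1 := prob_names_perturbation_le μ (Literature.Probability.Distributions.roundedGaussian J.n σ)
    red lift run dec hz0 (fun w => hred z w hzL)
  have h2 := Literature.Probability.Distributions.tvDist_roundedGaussian_map_add_le_one_sub_exp J.n hσ z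
    (intVecToEuclidean J.n z) (fun i => intVecToEuclidean_apply J.n z i)
  -- monotonicity of the tail term in the norm of the shift
  have h3 : Real.exp (-(D / (2 * σ) + 1) ^ 2 / 2) ≤
      Real.exp (-(‖intVecToEuclidean J.n z‖ / (2 * σ) + 1) ^ 2 / 2) := by
    rw [Real.exp_le_exp]
    have ha : 0 ≤ ‖intVecToEuclidean J.n z‖ / (2 * σ) + 1 := by positivity
    have hb : ‖intVecToEuclidean J.n z‖ / (2 * σ) + 1 ≤ D / (2 * σ) + 1 := by
      gcongr
    have := pow_le_pow_left₀ ha hb 2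
    linarith
  have h4 : 0 ≤ (Real.sqrt (2 * Real.pi))⁻¹ := by positivity
  nlinarith [mul_le_mul_of_nonneg_left h3 h4]

/-- **The hiding advantage at width `σ(D)` is inverse-polynomial**: for `n ≥ 3` and `D > 0`,
`(2π)^{-1/2} e^{-(D/(2σ(D))+1)²/2}/2 ≥ 1/(9 n¹²)` (`D/(2σ(D)) = 4√(log n)`,
`(4√(log n)+1)² ≤ 24 log n + 1` for `log n ≥ 1`, `2√(2π e) ≤ 9`). [folklore] -/
theorem inv_poly_le_hiding_advantage {n : ℕ} (hn : 3 ≤ n) {D : ℝ} (hD : 0 < D) :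
    1 / (9 * (n : ℝ) ^ 12) ≤
      (Real.sqrt (2 * Real.pi))⁻¹ * Real.exp (-(D / (2 * perturbWidth n D) + 1) ^ 2 / 2) / 2 := by
  set L := Real.sqrt (Real.log n) with hLdef
  have hn3 : (3 : ℝ) ≤ n := by exact_mod_cast hn
  have hnpos : (0 : ℝ) < n := by linarith
  have hlog1 : 1 ≤ Real.log n := by
    rw [← Real.log_exp 1]
    refine Real.log_le_log (Real.exp_pos 1) (le_trans ?_ hn3)
    have := Real.exp_one_lt_d9
    linarith
  have hL1 : 1 ≤ L := by
    rw [hLdef, show (1 : ℝ) = Real.sqrt 1 by simp]; exact Real.sqrt_le_sqrt hlog1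
  have hLpos : 0 < L := lt_of_lt_of_le one_pos hL1
  have hLsq : L * L = Real.log n := Real.mul_self_sqrt (by linarith)
  -- `D/(2σ(D)) = 4L`
  have hL0 : L ≠ 0 := hLpos.ne'
  have hratio : D / (2 * perturbWidth n D) = 4 * L := by
    rw [perturbWidth, ← hLdef]
    field_simp
    ring
  rw [hratio]
  -- `(4L+1)² ≤ 24 log n + 1`
  have hsq : (4 * L + 1) ^ 2 ≤ 24 * Real.log n + 1 := by
    have : L ≤ L * L := by nlinarith
    nlinarith
  have hexp : Real.exp (-(12 : ℝ)  * Real.log n - 1 / 2) ≤ Real.exp (-(4 * L + 1) ^ 2 / 2) := by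
    rw [Real.exp_le_exp]; linarith
  -- `e^{-12 log n - 1/2} = e^{-1/2} / n¹²`
  have hpow : Real.exp (-(12 : ℝ) * Real.log n - 1 / 2) = Real.exp (-(1 / 2)) / (n : ℝ) ^ 12 := by
    rw [show -(12 : ℝ) * Real.log n - 1 / 2 = -(1 / 2) - (12 : ℕ) * Real.log n by push_cast; ring,
      Real.exp_sub, Real.exp_nat_mul, Real.exp_log hnpos]
  -- numerical constants: `√(2π) ≤ 2.51`, `e^{1/2} ≤ 1.65`
  have hsqrt2pi : Real.sqrt (2 * Real.pi) ≤ 251 / 100 := by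
    rw [Real.sqrt_le_iff]
    refine ⟨by norm_num, ?_⟩
    have := Real.pi_lt_d2
    nlinarith
  have hexphalf : Real.exp (1 / 2) ≤ 165 / 100 := by
    have h := Real.exp_one_lt_d9
    have h2 : Real.exp (1 / 2) * Real.exp (1 / 2) = Real.exp 1 := by
      rw [← Real.exp_add]; norm_num
    nlinarith [Real.exp_pos (1 / 2 : ℝ)]
  have hA : 100 / 251 ≤ (Real.sqrt (2 * Real.pi))⁻¹ := by
    rw [le_inv_comm₀ (by norm_num) (Real.sqrt_pos.2 (by positivity)), inv_div]
    exact hsqrt2pi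
  have hE : 100 / 165 ≤ Real.exp (-(1 / 2)) := by
    rw [Real.exp_neg, le_inv_comm₀ (by norm_num) (Real.exp_pos _), inv_div]
    exact hexphalf
  have hn12 : 0 < (n : ℝ) ^ 12 := by positivity
  have hstep : (100 / 251 : ℝ) * (100 / 165 / (n : ℝ) ^ 12) ≤
      (Real.sqrt (2 * Real.pi))⁻¹ * (Real.exp (-(1 / 2)) / (n : ℝ) ^ 12) :=
    mul_le_mul hA (div_le_div_of_nonneg_right hE hn12.le) (by positivity) (by positivity)
  have hlast : (Real.sqrt (2 * Real.pi))⁻¹ * Real.exp (-(12 : ℝ) * Real.log n - 1 / 2) ≤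
      (Real.sqrt (2 * Real.pi))⁻¹ * Real.exp (-(4 * L + 1) ^ 2 / 2) :=
    mul_le_mul_of_nonneg_left hexp (by positivity)
  calc 1 / (9 * (n : ℝ) ^ 12) = (1 / 9) / (n : ℝ) ^ 12 := by rw [div_div]
    _ ≤ ((100 / 251) * (100 / 165) / 2) / (n : ℝ) ^ 12 := div_le_div_of_nonneg_right (by norm_num) hn12.le
    _ = (100 / 251 : ℝ) * (100 / 165 / (n : ℝ) ^ 12) / 2 := by ring
    _ ≤ (Real.sqrt (2 * Real.pi))⁻¹ * (Real.exp (-(1 / 2)) / (n : ℝ) ^ 12) / 2 :=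
        div_le_div_of_nonneg_right hstep zero_le_two
    _ = (Real.sqrt (2 * Real.pi))⁻¹ * Real.exp (-(12 : ℝ) * Real.log n - 1 / 2) / 2 := by rw [hpow, mul_div_assoc]
    _ ≤ (Real.sqrt (2 * Real.pi))⁻¹ * Real.exp (-(4 * L + 1) ^ 2 / 2) / 2 :=
        div_le_div_of_nonneg_right hlast zero_le_two

end Peikert2009

end Literature.Computability.Cryptography

end
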